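import Mathlib.Analysis.Normed.Lp.lpSpace
import Mathlib.Analysis.Calculus.MeanValue
import HarnessLib

/-!
# Calculus on `ℓ^∞`: diagonal operators and strict differentiability of the Nemytskii operator

Auxiliary (folklore) file of the series formalising [BBS-rg-flow] (Bauerschmidt–Brydges–Slade, AHP 16
(2015), arXiv:1211.2477) towards `Literature.Barriers.CriticalPhenomena.WeaklySAWFourDimLogCorrections`:
the functional-analytic tool for Theorem 1.4(ii) (smooth dependence of the fixed point of the flow map
`T` of `WeaklySAWFlowMap.lean`, which acts componentwise on `ℓ^∞(∏𝒲_j) × ℓ^∞(ℝ³)`).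

* `lpDiag`: a uniformly bounded family of bounded operators `T_i : E_i →L F_i` acts diagonally on
  `ℓ^∞` (`lp E ∞ →L lp F ∞`), with `‖diag T‖ ≤ sup‖T_i‖` and `‖diag T - diag T'‖ ≤ sup‖T_i - T'_i‖`;
* `hasStrictFDerivAt_lpNemytskii`: if each `f_i : E_i → F_i` is differentiable on the ball
  `B(x⁰_i, r)` with `‖f_i(x⁰_i)‖`, `‖Df_i(x⁰_i)‖` bounded and `Df_i` `L`-Lipschitz on the ball, all
  uniformly in `i`, then the componentwise (Nemytskii) operator `X ↦ (f_i(X_i))_i` on `ℓ^∞` is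
  STRICTLY Fréchet differentiable at `x⁰` with derivative `diag(Df_i(x⁰_i))` (componentwise mean value
  inequality with reference operator); its derivative is `L`-Lipschitz on the ball
  (`norm_lpDiag_fderiv_sub_le`).

## References
* R. Bauerschmidt, D. C. Brydges, G. Slade, arXiv:1211.2477, Lemma 3.3 (3.11) and §3.4 (the role of
  the second derivatives in the smoothness of the flow). [BauerschmidtBrydgesSlade2015Flow]
-/

noncomputable section

open Filter Topology Set

namespace Literature.Barriers.CriticalPhenomena

namespace CTWSAW

/-! ## Calculus on `ℓ^∞`: diagonal operators and the Nemytskii (componentwise) operator -/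

open scoped ENNReal

section SeqSpaceCalculus

variable {ι : Type*} {E F : ι → Type*} [∀ i, NormedAddCommGroup (E i)] [∀ i, NormedSpace ℝ (E i)]
  [∀ i, NormedAddCommGroup (F i)] [∀ i, NormedSpace ℝ (F i)]

/-- A uniformly bounded family of bounded operators `T_i : E_i → F_i` acts diagonally on `ℓ^∞`.
[folklore] -/
def lpDiagLin (T : ∀ i, E i →L[ℝ] F i) {C : ℝ} (hT : ∀ i, ‖T i‖ ≤ C) : lp E ∞ →ₗ[ℝ] lp F ∞ where
  toFun f := ⟨fun i => T i (f i), memℓp_infty ⟨max C 0 * ‖f‖, by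
    rintro _ ⟨i, rfl⟩
    calc ‖T i (f i)‖ ≤ ‖T i‖ * ‖f i‖ := (T i).le_opNorm _
      _ ≤ max C 0 * ‖f‖ := mul_le_mul ((hT i).trans (le_max_left _ _))
          (lp.norm_apply_le_norm ENNReal.top_ne_zero f i) (norm_nonneg _) (le_max_right _ _)⟩⟩
  map_add' f g := by ext i; simp
  map_smul' a f := by ext i; simp

/-- The diagonal operator `(f_i)_i ↦ (T_if_i)_i` on `ℓ^∞` as a bounded operator, `‖diag T‖ ≤ max(C, 0)`. [folklore] -/
def lpDiag (T : ∀ i, E i →L[ℝ] F i) {C : ℝ} (hT : ∀ i, ‖T i‖ ≤ C) : lp E ∞ →L[ℝ] lp F ∞ :=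
  (lpDiagLin T hT).mkContinuous (max C 0) fun f =>
    lp.norm_le_of_forall_le (by positivity) fun i =>
      calc ‖T i (f i)‖ ≤ ‖T i‖ * ‖f i‖ := (T i).le_opNorm _
        _ ≤ max C 0 * ‖f‖ := mul_le_mul ((hT i).trans (le_max_left _ _))
            (lp.norm_apply_le_norm ENNReal.top_ne_zero f i) (norm_nonneg _) (le_max_right _ _)

/-- Unfolding. [folklore] -/
@[simp] theorem lpDiag_apply (T : ∀ i, E i →L[ℝ] F i) {C : ℝ} (hT : ∀ i, ‖T i‖ ≤ C) (f : lp E ∞) (i : ι) :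
    (lpDiag T hT f : ∀ i, F i) i = T i (f i) := rfl

/-- `‖diag T‖ ≤ max(C, 0)`. [folklore] -/
theorem norm_lpDiag_le (T : ∀ i, E i →L[ℝ] F i) {C : ℝ} (hT : ∀ i, ‖T i‖ ≤ C) : ‖lpDiag T hT‖ ≤ max C 0 :=
  LinearMap.mkContinuous_norm_le _ (by positivity) _

/-- Two diagonal operators differ by at most the supremum of the componentwise differences. [folklore] -/
theorem norm_lpDiag_sub_lpDiag_le (T T' : ∀ i, E i →L[ℝ] F i) {C C' D : ℝ} (hT : ∀ i, ‖T i‖ ≤ C)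
    (hT' : ∀ i, ‖T' i‖ ≤ C') (hD : 0 ≤ D) (h : ∀ i, ‖T i - T' i‖ ≤ D) : ‖lpDiag T hT - lpDiag T' hT'‖ ≤ D := by
  refine ContinuousLinearMap.opNorm_le_bound _ hD fun f => ?_
  refine lp.norm_le_of_forall_le (by positivity) fun i => ?_
  have e : ((lpDiag T hT - lpDiag T' hT') f : ∀ i, F i) i = (T i - T' i) (f i) := by
    show ((lpDiag T hT f - lpDiag T' hT' f : lp F ∞) : ∀ i, F i) i = _
    rw [lp.coeFn_sub, Pi.sub_apply, lpDiag_apply, lpDiag_apply]; rfl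
  rw [e]
  calc ‖(T i - T' i) (f i)‖ ≤ ‖T i - T' i‖ * ‖f i‖ := (T i - T' i).le_opNorm _
    _ ≤ D * ‖f‖ := mul_le_mul (h i) (lp.norm_apply_le_norm ENNReal.top_ne_zero f i) (norm_nonneg _) hD

open Classical in
/-- Truncation of a family to `ℓ^∞` (identity on bounded families). [folklore] -/
def toLp (g : ∀ i, F i) : lp F ∞ := if hg : Memℓp g ∞ then ⟨g, hg⟩ else 0

omit [∀ i, NormedSpace ℝ (F i)] in
/-- `toLp` is the identity on bounded families. [folklore] -/
theorem coe_toLp {g : ∀ i, F i} (hg : Memℓp g ∞) : (toLp g : ∀ i, F i) = g := by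
  simp [toLp, hg]

/-- **The Nemytskii operator on `ℓ^∞` is strictly Fréchet differentiable** with the diagonal derivative:
if each `f_i` is differentiable on the ball `B(x⁰_i, r)` with `‖f_i(x⁰_i)‖ ≤ B₀`, `‖Df_i(x⁰_i)‖ ≤ C` and
`L`-Lipschitz derivative on the ball (all uniformly in `i`), then `X ↦ (f_i(X_i))_i` is strictly
differentiable at `x⁰ ∈ ℓ^∞` with derivative `diag(Df_i(x⁰_i))`. [folklore] -/
theorem hasStrictFDerivAt_lpNemytskii {x₀ : lp E ∞} {r L C B₀ : ℝ} (hr : 0 < r) (hL : 0 ≤ L)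
    (f : ∀ i, E i → F i) (f' : ∀ i, E i → (E i →L[ℝ] F i))
    (hf : ∀ i, ∀ y ∈ Metric.closedBall (x₀ i) r, HasFDerivAt (f i) (f' i y) y)
    (hB : ∀ i, ‖f i (x₀ i)‖ ≤ B₀) (hC : ∀ i, ‖f' i (x₀ i)‖ ≤ C)
    (hLip : ∀ i, ∀ y ∈ Metric.closedBall (x₀ i) r, ∀ z ∈ Metric.closedBall (x₀ i) r, ‖f' i y - f' i z‖ ≤ L * ‖y - z‖) :
    HasStrictFDerivAt (fun X : lp E ∞ => toLp (fun i => f i (X i))) (lpDiag (fun i => f' i (x₀ i)) hC) x₀ := by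
  -- derivative bound on the ball
  have hC' : ∀ i, ∀ y ∈ Metric.closedBall (x₀ i) r, ‖f' i y‖ ≤ C + L * r := by
    intro i y hy
    have := hLip i y hy (x₀ i) (Metric.mem_closedBall_self hr.le)
    rw [Metric.mem_closedBall, dist_eq_norm] at hy
    calc ‖f' i y‖ = ‖f' i (x₀ i) + (f' i y - f' i (x₀ i))‖ := by rw [add_sub_cancel]
      _ ≤ ‖f' i (x₀ i)‖ + ‖f' i y - f' i (x₀ i)‖ := norm_add_le _ _
      _ ≤ C + L * ‖y - x₀ i‖ := add_le_add (hC i) this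
      _ ≤ C + L * r := by gcongr
  -- components of points of the `ℓ^∞`-ball lie in the componentwise balls
  have hcomp : ∀ {X : lp E ∞}, ‖X - x₀‖ ≤ r → ∀ i, X i ∈ Metric.closedBall (x₀ i) r := fun {X} hX i => by
    rw [Metric.mem_closedBall, dist_eq_norm]
    have := lp.norm_apply_le_norm ENNReal.top_ne_zero (X - x₀) i
    rw [lp.coeFn_sub, Pi.sub_apply] at this
    exact this.trans hX
  -- values are bounded on the ball, so `toLp` is the identity there
  have hmem : ∀ {X : lp E ∞}, ‖X - x₀‖ ≤ r → Memℓp (fun i => f i (X i)) ∞ := fun {X} hX => by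
    refine memℓp_infty ⟨B₀ + (C + L * r) * r, ?_⟩
    rintro _ ⟨i, rfl⟩
    have hXi := hcomp hX i
    have hmv := (convex_closedBall (x₀ i) r).norm_image_sub_le_of_norm_hasFDerivWithin_le
      (fun y hy => (hf i y hy).hasFDerivWithinAt) (fun y hy => hC' i y hy) hXi (Metric.mem_closedBall_self hr.le)
    have hdist : ‖x₀ i - X i‖ ≤ r := by rw [← dist_eq_norm, dist_comm]; exact hXi
    calc ‖f i (X i)‖ = ‖f i (x₀ i) - (f i (x₀ i) - f i (X i))‖ := by rw [sub_sub_cancel]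
      _ ≤ ‖f i (x₀ i)‖ + ‖f i (x₀ i) - f i (X i)‖ := norm_sub_le _ _
      _ ≤ B₀ + (C + L * r) * ‖x₀ i - X i‖ := add_le_add (hB i) hmv
      _ ≤ B₀ + (C + L * r) * r := by
          gcongr
          have := hC i; have := norm_nonneg (f' i (x₀ i)); nlinarith
  -- the strict remainder estimate, componentwise by the mean value inequality with reference operator
  have hrem : ∀ {X Y : lp E ∞}, ‖X - x₀‖ ≤ r → ‖Y - x₀‖ ≤ r → ∀ i,
      ‖f i (X i) - f i (Y i) - f' i (x₀ i) (X i - Y i)‖ ≤ L * max ‖X - x₀‖ ‖Y - x₀‖ * ‖X i - Y i‖ := by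
    intro X Y hX hY i
    set ρ := max ‖X - x₀‖ ‖Y - x₀‖ with hρ
    have hρr : ρ ≤ r := max_le hX hY
    have hXi : X i ∈ Metric.closedBall (x₀ i) ρ := by
      rw [Metric.mem_closedBall, dist_eq_norm]
      have := lp.norm_apply_le_norm ENNReal.top_ne_zero (X - x₀) i
      rw [lp.coeFn_sub, Pi.sub_apply] at this
      exact this.trans (le_max_left _ _)
    have hYi : Y i ∈ Metric.closedBall (x₀ i) ρ := by
      rw [Metric.mem_closedBall, dist_eq_norm]
      have := lp.norm_apply_le_norm ENNReal.top_ne_zero (Y - x₀) i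
      rw [lp.coeFn_sub, Pi.sub_apply] at this
      exact this.trans (le_max_right _ _)
    have hsub : Metric.closedBall (x₀ i) ρ ⊆ Metric.closedBall (x₀ i) r := Metric.closedBall_subset_closedBall hρr
    have hbd : ∀ y ∈ Metric.closedBall (x₀ i) ρ, ‖f' i y - f' i (x₀ i)‖ ≤ L * ρ := fun y hy => by
      have h1 := hLip i y (hsub hy) (x₀ i) (Metric.mem_closedBall_self hr.le)
      rw [Metric.mem_closedBall, dist_eq_norm] at hy
      exact h1.trans (by gcongr)
    have := (convex_closedBall (x₀ i) ρ).norm_image_sub_le_of_norm_hasFDerivWithin_le'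
      (fun y hy => (hf i y (hsub hy)).hasFDerivWithinAt) hbd hYi hXi
    simpa [mul_comm, mul_assoc, mul_left_comm] using this
  -- conclusion: strict differentiability from the quadratic-type bound
  rw [hasStrictFDerivAt_iff_isLittleO]
  refine Asymptotics.IsLittleO.of_bound fun ε hε => ?_
  have hδ : 0 < min r (ε / (L + 1)) := lt_min hr (div_pos hε (by linarith))
  have hball : ∀ᶠ p : lp E ∞ × lp E ∞ in nhds (x₀, x₀), ‖p.1 - x₀‖ < min r (ε / (L + 1)) ∧ ‖p.2 - x₀‖ < min r (ε / (L + 1)) := by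
    have hb : ∀ᶠ y : lp E ∞ in nhds x₀, ‖y - x₀‖ < min r (ε / (L + 1)) :=
      Filter.eventually_of_mem (Metric.ball_mem_nhds x₀ hδ) fun y hy => by
        rwa [Metric.mem_ball, dist_eq_norm] at hy
    have h1 : ∀ᶠ p : lp E ∞ × lp E ∞ in nhds (x₀, x₀), ‖p.1 - x₀‖ < min r (ε / (L + 1)) :=
      (continuous_fst.tendsto (x₀, x₀)).eventually hb
    have h2 : ∀ᶠ p : lp E ∞ × lp E ∞ in nhds (x₀, x₀), ‖p.2 - x₀‖ < min r (ε / (L + 1)) :=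
      (continuous_snd.tendsto (x₀, x₀)).eventually hb
    exact h1.and h2
  refine hball.mono fun p hp => ?_
  obtain ⟨h1, h2⟩ := hp
  have hX : ‖p.1 - x₀‖ ≤ r := (h1.trans_le (min_le_left _ _)).le
  have hY : ‖p.2 - x₀‖ ≤ r := (h2.trans_le (min_le_left _ _)).le
  have hρ : max ‖p.1 - x₀‖ ‖p.2 - x₀‖ ≤ ε / (L + 1) := max_le (h1.le.trans (min_le_right _ _)) (h2.le.trans (min_le_right _ _))
  have hcoe1 : ((toLp fun i => f i (p.1 i)) : ∀ i, F i) = fun i => f i (p.1 i) := coe_toLp (hmem hX)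
  have hcoe2 : ((toLp fun i => f i (p.2 i)) : ∀ i, F i) = fun i => f i (p.2 i) := coe_toLp (hmem hY)
  refine lp.norm_le_of_forall_le (by positivity) fun i => ?_
  simp only [lp.coeFn_sub, Pi.sub_apply, map_sub, hcoe1, hcoe2, lpDiag_apply]
  have hi := hrem hX hY i
  have hnorm : ‖p.1 i - p.2 i‖ ≤ ‖p.1 - p.2‖ := by
    have := lp.norm_apply_le_norm ENNReal.top_ne_zero (p.1 - p.2) i
    rwa [lp.coeFn_sub, Pi.sub_apply] at this
  calc ‖f i (p.1 i) - f i (p.2 i) - ((f' i (x₀ i)) (p.1 i) - (f' i (x₀ i)) (p.2 i))‖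
      = ‖f i (p.1 i) - f i (p.2 i) - f' i (x₀ i) (p.1 i - p.2 i)‖ := by rw [map_sub]
    _ ≤ L * max ‖p.1 - x₀‖ ‖p.2 - x₀‖ * ‖p.1 i - p.2 i‖ := hi
    _ ≤ L * (ε / (L + 1)) * ‖p.1 - p.2‖ := by gcongr
    _ ≤ ε * ‖p.1 - p.2‖ := by
        refine mul_le_mul_of_nonneg_right ?_ (norm_nonneg _)
        rw [mul_div_assoc']
        rw [div_le_iff₀ (by linarith)]
        nlinarith

/-- The diagonal derivative of the Nemytskii operator is Lipschitz on the ball. [folklore] -/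
theorem norm_lpDiag_fderiv_sub_le {x₀ : lp E ∞} {r L : ℝ} (hL : 0 ≤ L)
    (f' : ∀ i, E i → (E i →L[ℝ] F i))
    (hLip : ∀ i, ∀ y ∈ Metric.closedBall (x₀ i) r, ∀ z ∈ Metric.closedBall (x₀ i) r, ‖f' i y - f' i z‖ ≤ L * ‖y - z‖)
    {X Y : lp E ∞} (hX : ‖X - x₀‖ ≤ r) (hY : ‖Y - x₀‖ ≤ r)
    {CX CY : ℝ} (hCX : ∀ i, ‖f' i (X i)‖ ≤ CX) (hCY : ∀ i, ‖f' i (Y i)‖ ≤ CY) :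
    ‖lpDiag (fun i => f' i (X i)) hCX - lpDiag (fun i => f' i (Y i)) hCY‖ ≤ L * ‖X - Y‖ := by
  have hcomp : ∀ {Z : lp E ∞}, ‖Z - x₀‖ ≤ r → ∀ i, Z i ∈ Metric.closedBall (x₀ i) r := fun {Z} hZ i => by
    rw [Metric.mem_closedBall, dist_eq_norm]
    have := lp.norm_apply_le_norm ENNReal.top_ne_zero (Z - x₀) i
    rw [lp.coeFn_sub, Pi.sub_apply] at this
    exact this.trans hZ
  refine norm_lpDiag_sub_lpDiag_le _ _ hCX hCY (by positivity) fun i => ?_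
  have hnorm : ‖X i - Y i‖ ≤ ‖X - Y‖ := by
    have := lp.norm_apply_le_norm ENNReal.top_ne_zero (X - Y) i
    rwa [lp.coeFn_sub, Pi.sub_apply] at this
  calc ‖f' i (X i) - f' i (Y i)‖ ≤ L * ‖X i - Y i‖ := hLip i _ (hcomp hX i) _ (hcomp hY i)
    _ ≤ L * ‖X - Y‖ := by gcongr

end SeqSpaceCalculus


end CTWSAW

end Literature.Barriers.CriticalPhenomena
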